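import Summits.ResolutionOfSingularities.ResolutionOfSingularities.Theorems.PurelyInseparableDim4ResConeStretchLedgerLinear
import Summits.ResolutionOfSingularities.ResolutionOfSingularities.Theorems.PurelyInseparableDim4ResConeTwoSlotDivisibilityPow
import Summits.ResolutionOfSingularities.ResolutionOfSingularities.Theorems.PurelyInseparableDim4ResConeLayerBirths
import Summits.ResolutionOfSingularities.ResolutionOfSingularities.Theorems.PurelyInseparableDim4TschirnhausStraighten
import HarnessLib
import HarnessLib.Audit.Tags

/-!
# Purely inseparable four-folds — THE EXACT PAIR LEDGER READ IN THE STRAIGHTENED FRAME: after the LINEAR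
# straightening `x_f ↦ x_f − Σ_{i≠f}(ℓᵢ/ℓ_f)xᵢ` every residual monomial of `x_f`-degree `< d` off `(x_a x_{a′})`
# vanishes — at EVERY degree; the support form survives cleaning and any re-framing of a fourth letter
# (cell `res-dim4-pi`, K2(p) lane, slice B; C∞ assembly K24c L2b)

[OURS · counted 0 · cell `res-dim4-pi` · K2(p) lane holder res-dim4-p-12 g3; C∞ assembly owner res-dim4-p-3 g4
(design point (B) «the pair ledger is exact», bus 2026-08-29 03:37Z, K-side check res-dim4-crit-4 g4 03:38Z).]
Nothing here proves K2(p) (`RidgeBudget.NoAboveFloorTrap p p`), `NoIsolatedTrap p p` or resolution of singularities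
in dimension ≥ 4 / characteristic `p` — NOT proved.  AI kernel work, weaker than expert review.

INPUT: the exact pair ledger of (K11-lin) `…ResConeStretchLedgerLinear.stretch_pair_ledger_linear`,
`U·G = S·(x_a x_{a′}) + T·L^d` with `L = Σ ℓᵢ xᵢ` the current vertex form and `U(0) ≠ 0`, and a re-framing `tsch f φ`
of a free letter `f ∉ {a, a′}` that STRAIGHTENS the form, `tsch f φ L = ℓ_f·x_f` (res-dim4-p-11 g3's linear datum
`φ_ℓ`, `FrameChange.tsch_linearForm_straighten`; any `φ` with this property will do).
* §1 `tsch_pair_ledger_of_straight` — the ledger rides the re-framing: `Ũ·G̃ = S̃·(x_a x_{a′}) + T̃·(ℓ_f x_f)^d`, now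
  in res-dim4-typ-1 g3's CONTACT FORM with `H = x_f·C ℓ_f + 0`; hence **`coeff_tsch_eq_zero_of_pair_ledger_linear`**:
  `coeff_n G̃ = 0` for EVERY `n` with `n_f < d` and `n_a = 0 ∨ n_{a′} = 0` (typ-1's `coeff_eq_zero_of_pair_ledger_pow`
  with `R = 0 ∈ 𝔪₀^M` for every `M`) — no jet order.
* §2 THE SUPPORT FORM «every monomial of `F̃ = x^r·G̃` of `x_f`-degree `< d` has `x_a`-exponent `≥ r_a + 1` and
  `x_{a′}`-exponent `≥ r_{a′} + 1`» (`lowLedger_tsch_of_pair_ledger_linear`; at `r = x_λ x_μ`, `d = 4` this is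
  res-dim4-p-2 g4's F2a hypothesis `hled` with `N = ∞`) and its STABILITY: under cleaning (`lowLedger_deletePthPowers`,
  monomials are only deleted) and under ANY re-framing `tsch u ψ` of a fourth letter `u ∉ {a, a′, f}`
  (`lowLedger_tsch_of_ne`: by res-dim4-p-5 g3's `erase_le_of_mem_support_tsch_monomial` the `a, a′, f`-exponents only
  grow) — so the second Tschirnhaus of res-dim4-typ-1 g3's (E-u) and the walk's re-cleanings keep it.
* §3 `lowLedger_frame_of_born_linear` — the chain-level corollary: on a power-cone stretch (`1 ≤ d`), at a stage where
  two distinct boundary letters are stretch-born and kept and a free letter `f` (`r_k f = 0`) carries the vertex form,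
  the straightened cleaned state `clean (tsch f φ_ℓ F_k)` has the support form — EXACTLY (compare res-dim4-p-1 g4's
  jet-level `frame_reading_eq_zero_of_born` / typ-1's `frame_reading_eq_zero_of_born_pow`, order `N`).

[cite: CossartJannsenSaito2020, Thm. 3.10(4), Thm. 3.14] [cite: Kollar2007, Aside 3.57]
bears_on: LADDER-RESOLUTION:D157-DOOR2 (res-dim4-pi · K2(p) slice B · exact pair ledger in the frame).
Supports stmt-ResolutionOfSingularities-16155 (helper).
-/

set_option linter.dupNamespace false -- mandated namespace of this single-conjunct summit

noncomputable section

namespace Summit.ResolutionOfSingularities.ResolutionOfSingularities.Theorems.PIDim4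

namespace ResCone

open MvPolynomial Finset FrameChange
open Literature.AlgebraicGeometry.Resolution
open Literature.AlgebraicGeometry.Resolution.CentreBlowup
open Literature.AlgebraicGeometry.Resolution.Hauser2010
open Literature.AlgebraicGeometry.Resolution.HauserPerlega2019
open PointBlowup (polarMap additiveSubspace direction)

variable {K : Type} [Field K]

/-! ## §1 The exact read-off after straightening -/

/-- **The pair ledger rides a straightening re-framing**: if `tsch f φ` maps the vertex form `Σ ℓᵢ xᵢ` to `ℓ_f·x_f`
(`f ∉ {a, a′}`), the ledger `U·G = S·(x_a x_{a′}) + T·(Σ ℓᵢ xᵢ)^d` becomes `Ũ·G̃ = S̃·(x_a x_{a′}) + T̃·(ℓ_f x_f)^d`.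
[folklore] -/
theorem tsch_pair_ledger_of_straight {a a' f : Fin 4} (haf : a ≠ f) (ha'f : a' ≠ f) {φ : MvPolynomial (Fin 4) K}
    {ℓ : Fin 4 → K} (hφL : tsch f φ (∑ i, C (ℓ i) * X i) = C (ℓ f) * X f) {G U S T : MvPolynomial (Fin 4) K}
    {d : ℕ} (hledger : U * G = S * (X a * X a') + T * (∑ i, C (ℓ i) * X i) ^ d) :
    tsch f φ U * tsch f φ G = tsch f φ S * (X a * X a') + tsch f φ T * (C (ℓ f) * X f) ^ d := by
  have h := congrArg (tsch f φ) hledger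
  simp only [map_mul, map_add, map_pow, tsch_X_of_ne φ haf, tsch_X_of_ne φ ha'f, hφL] at h
  exact h

/-- **EXACT READ-OFF IN THE STRAIGHTENED FRAME**: with a straightening re-framing `tsch f φ` (`φ(0) = 0`) and an exact
pair ledger `U·G = S·(x_a x_{a′}) + T·(Σ ℓᵢ xᵢ)^d`, `U(0) ≠ 0`: `coeff_n (tsch f φ G) = 0` for EVERY exponent `n` with
`n_f < d` and `n_a = 0 ∨ n_{a′} = 0` — res-dim4-typ-1 g3's `coeff_eq_zero_of_pair_ledger_pow` in contact form
`H = x_f·C ℓ_f + 0`, `R = 0 ∈ 𝔪₀^M` for every `M`. [OURS] [cite: CossartJannsenSaito2020, Thm. 3.14] -/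
theorem coeff_tsch_eq_zero_of_pair_ledger_linear {a a' f : Fin 4} (haf : a ≠ f) (ha'f : a' ≠ f)
    {φ : MvPolynomial (Fin 4) K} (h0 : constantCoeff φ = 0) {ℓ : Fin 4 → K}
    (hφL : tsch f φ (∑ i, C (ℓ i) * X i) = C (ℓ f) * X f) {G U S T : MvPolynomial (Fin 4) K} {d : ℕ}
    (hU : MvPolynomial.eval (0 : Fin 4 → K) U ≠ 0)
    (hledger : U * G = S * (X a * X a') + T * (∑ i, C (ℓ i) * X i) ^ d) {n : Fin 4 →₀ ℕ} (hnf : n f < d)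
    (hn : n a = 0 ∨ n a' = 0) : coeff n (tsch f φ G) = 0 := by
  have hU' : constantCoeff (tsch f φ U) ≠ 0 := by
    rw [constantCoeff_tsch h0, ← MvPolynomial.eval_zero]; exact hU
  have hH : (C (ℓ f) * X f : MvPolynomial (Fin 4) K) = X f * C (ℓ f) + 0 := by rw [mul_comm, add_zero]
  exact coeff_eq_zero_of_pair_ledger_pow hU' (tsch_pair_ledger_of_straight haf ha'f hφL hledger) hH
    (Ideal.zero_mem (originIdeal K ^ (n.degree + 1))) (Nat.lt_succ_self _) hnf hn

/-- **… and after any further re-framing `τ` fixing `x_a`, `x_{a′}`, `x_f` and the origin** (the second Tschirnhaus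
`x_u ↦ x_u + ψ(x_a, x_{a′})` of res-dim4-typ-1 g3's (E-u)): `coeff_n (τ (tsch f φ G)) = 0` for every such `n`
(typ-1's `coeff_map_eq_zero_of_pair_ledger_pow`). [OURS] [cite: CossartJannsenSaito2020, Thm. 3.14] -/
theorem coeff_map_tsch_eq_zero_of_pair_ledger_linear (τ : MvPolynomial (Fin 4) K →ₐ[K] MvPolynomial (Fin 4) K)
    {a a' f : Fin 4} (hτa : τ (X a) = X a) (hτa' : τ (X a') = X a') (hτf : τ (X f) = X f)
    (hτ0 : ∀ i, constantCoeff (τ (X i)) = 0) (haf : a ≠ f) (ha'f : a' ≠ f) {φ : MvPolynomial (Fin 4) K}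
    (h0 : constantCoeff φ = 0) {ℓ : Fin 4 → K} (hφL : tsch f φ (∑ i, C (ℓ i) * X i) = C (ℓ f) * X f)
    {G U S T : MvPolynomial (Fin 4) K} {d : ℕ} (hU : MvPolynomial.eval (0 : Fin 4 → K) U ≠ 0)
    (hledger : U * G = S * (X a * X a') + T * (∑ i, C (ℓ i) * X i) ^ d) {n : Fin 4 →₀ ℕ} (hnf : n f < d)
    (hn : n a = 0 ∨ n a' = 0) : coeff n (τ (tsch f φ G)) = 0 := by
  have hU' : constantCoeff (tsch f φ U) ≠ 0 := by
    rw [constantCoeff_tsch h0, ← MvPolynomial.eval_zero]; exact hU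
  have hH : (C (ℓ f) * X f : MvPolynomial (Fin 4) K) = X f * C (ℓ f) + 0 := by rw [mul_comm, add_zero]
  exact coeff_map_eq_zero_of_pair_ledger_pow τ hτa hτa' hτf hτ0 hU' (tsch_pair_ledger_of_straight haf ha'f hφL hledger)
    hH (Ideal.zero_mem (originIdeal K ^ (n.degree + 1))) (Nat.lt_succ_self _) hnf hn

/-! ## §2 The support form and its stability -/

/-- **THE SUPPORT FORM of the exact ledger** (`F̃ = x^r·G̃`, `r_f = 0`): every monomial of `tsch f φ F` of
`x_f`-degree `< d` has `x_a`-exponent `≥ r_a + 1` and `x_{a′}`-exponent `≥ r_{a′} + 1`; at `r = x_λ x_μ`, `d = 4` this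
is the frame hypothesis `hled` of res-dim4-p-2 g4's F2a `ledger_step_zero` / `exists_parent_of_coeff_step_zero_gameExp_of_ledger`
for EVERY `N`. [OURS] [cite: CossartJannsenSaito2020, Thm. 3.14] -/
theorem lowLedger_tsch_of_pair_ledger_linear {a a' f : Fin 4} (haf : a ≠ f) (ha'f : a' ≠ f)
    {φ : MvPolynomial (Fin 4) K} (h0 : constantCoeff φ = 0) {ℓ : Fin 4 → K}
    (hφL : tsch f φ (∑ i, C (ℓ i) * X i) = C (ℓ f) * X f) {F G U S T : MvPolynomial (Fin 4) K} {r : Fin 4 →₀ ℕ}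
    (hrf : r f = 0) (hF : F = monomial r 1 * G) {d : ℕ} (hU : MvPolynomial.eval (0 : Fin 4 → K) U ≠ 0)
    (hledger : U * G = S * (X a * X a') + T * (∑ i, C (ℓ i) * X i) ^ d) :
    ∀ e ∈ (tsch f φ F).support, e f < d → r a + 1 ≤ e a ∧ r a' + 1 ≤ e a' := by
  classical
  intro e he hef
  rw [hF, tsch_monomial_mul φ hrf, mem_support_iff, coeff_monomial_mul'] at he
  split_ifs at he with hre
  · rw [one_mul] at he
    have hna : ¬ ((e - r) a = 0 ∨ (e - r) a' = 0) := fun hn =>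
      he (coeff_tsch_eq_zero_of_pair_ledger_linear haf ha'f h0 hφL hU hledger
        (by rw [Finsupp.tsub_apply, hrf, tsub_zero]; exact hef) hn)
    push Not at hna
    have ha := hre a
    have ha' := hre a'
    rw [Finsupp.tsub_apply] at hna
    rw [Finsupp.tsub_apply] at hna
    omega
  · exact absurd rfl he

/-- **Cleaning keeps the support form** (it only deletes monomials). [folklore] -/
theorem lowLedger_deletePthPowers (q : ℕ) {a a' f : Fin 4} {d : ℕ} {ra ra' : ℕ} {P : MvPolynomial (Fin 4) K}
    (hP : ∀ e ∈ P.support, e f < d → ra ≤ e a ∧ ra' ≤ e a') :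
    ∀ e ∈ (deletePthPowers q P).support, e f < d → ra ≤ e a ∧ ra' ≤ e a' := by
  classical
  intro e he hef
  refine hP e ?_ hef
  rw [mem_support_iff] at he ⊢
  rw [coeff_deletePthPowers] at he
  split_ifs at he with h
  · exact absurd rfl he
  · exact he

/-- **Re-framing a FOURTH letter keeps the support form**: for `u ∉ {a, a′, f}` and ANY datum `ψ`, every monomial
of `tsch u ψ P` dominates, off `u`, a monomial of `P` (res-dim4-p-5 g3's `erase_le_of_mem_support_tsch_monomial`),
so `x_a`, `x_{a′}`-exponents only grow and the `x_f`-exponent does not drop. [folklore] -/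
theorem lowLedger_tsch_of_ne {u a a' f : Fin 4} (hua : u ≠ a) (hua' : u ≠ a') (huf : u ≠ f)
    (ψ : MvPolynomial (Fin 4) K) {d : ℕ} {ra ra' : ℕ} {P : MvPolynomial (Fin 4) K}
    (hP : ∀ e ∈ P.support, e f < d → ra ≤ e a ∧ ra' ≤ e a') :
    ∀ e ∈ (tsch u ψ P).support, e f < d → ra ≤ e a ∧ ra' ≤ e a' := by
  intro E hE hEf
  obtain ⟨e, he, hEe⟩ := exists_source_of_mem_support_tsch u ψ P hE
  have hle := erase_le_of_mem_support_tsch_monomial u ψ hEe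
  have ha : e a ≤ E a := by have h := hle a; rwa [Finsupp.erase_ne hua.symm] at h
  have ha' : e a' ≤ E a' := by have h := hle a'; rwa [Finsupp.erase_ne hua'.symm] at h
  have hf : e f ≤ E f := by have h := hle f; rwa [Finsupp.erase_ne huf.symm] at h
  obtain ⟨h1, h2⟩ := hP e he (lt_of_le_of_lt hf hEf)
  exact ⟨h1.trans ha, h2.trans ha'⟩

/-- **The support form in the doubly re-framed, re-cleaned presentation** `clean (tsch u ψ (clean (tsch f φ F)))`
(the frame the C∞ window is played in: straightened at `f`, second Tschirnhaus at `u`, cleaned after each move).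
[OURS] [cite: CossartJannsenSaito2020, Thm. 3.14] -/
theorem lowLedger_frame_of_pair_ledger_linear (q : ℕ) {u a a' f : Fin 4} (hua : u ≠ a) (hua' : u ≠ a')
    (huf : u ≠ f) (haf : a ≠ f) (ha'f : a' ≠ f) (ψ : MvPolynomial (Fin 4) K) {φ : MvPolynomial (Fin 4) K}
    (h0 : constantCoeff φ = 0) {ℓ : Fin 4 → K} (hφL : tsch f φ (∑ i, C (ℓ i) * X i) = C (ℓ f) * X f)
    {F G U S T : MvPolynomial (Fin 4) K} {r : Fin 4 →₀ ℕ} (hrf : r f = 0) (hF : F = monomial r 1 * G) {d : ℕ}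
    (hU : MvPolynomial.eval (0 : Fin 4 → K) U ≠ 0)
    (hledger : U * G = S * (X a * X a') + T * (∑ i, C (ℓ i) * X i) ^ d) :
    ∀ e ∈ (deletePthPowers q (tsch u ψ (deletePthPowers q (tsch f φ F)))).support, e f < d →
      r a + 1 ≤ e a ∧ r a' + 1 ≤ e a' :=
  lowLedger_deletePthPowers q (lowLedger_tsch_of_ne hua hua' huf ψ
    (lowLedger_deletePthPowers q (lowLedger_tsch_of_pair_ledger_linear haf ha'f h0 hφL hrf hF hU hledger)))

/-! ## §3 Along the chain: the straightened state of a stretch with two stretch-born kept letters -/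

section Chain

variable (p : ℕ) [hp : Fact p.Prime] [DecidableEq K]

/-- **THE EXACT LEDGER OF THE STRAIGHTENED FRAME ALONG THE CHAIN.**  On a power-cone stretch (`1 ≤ d`) of an isolated
above-floor `Step0 p` chain with `x^{r₀} ∣ F₀` and frame data, at a stage `k` where two distinct boundary letters
`a = j_{ta}`, `a′ = j_{ta′}` are stretch-born and kept and a free letter `f ∉ {a, a′}` (`r_k f = 0`) carries the vertex
form (`ℓ_k f ≠ 0`), the cleaned straightened state `clean (tsch f φ_ℓ F_k)` (res-dim4-p-11 g3's linear datum
`φ_ℓ = −Σ_{i≠f}(ℓ_k i/ℓ_k f)·xᵢ`) has the support form: every monomial of `x_f`-degree `< d` has `x_a`-exponent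
`≥ r_k a + 1` and `x_{a′}`-exponent `≥ r_k a′ + 1` — at EVERY degree. [OURS]
[cite: CossartJannsenSaito2020, Thm. 3.10(4), Thm. 3.14] -/
theorem lowLedger_frame_of_born_linear {c : ℕ → State K} {j : ℕ → Fin 4} {b : ℕ → Fin 4 → K}
    (hc : ∀ k, IsIsolated p (c k).F ∧ Step0 p (c k) (c (k + 1))) (hw : FreeTail.IsWitnessedChain p c j b)
    (hr0 : ∀ e ∈ (c 0).F.support, (c 0).r ≤ e) (hfloor : ∀ k, ordZero (c k).F ≠ p) {k₀ d : ℕ} (hd : 1 ≤ d)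
    (hshade : ∀ k, k₀ ≤ k → (c k).shade = (d : ℕ∞)) {ℓ : ℕ → Fin 4 → K} {a0 lam : ℕ → K}
    (hform : ∀ k, k₀ ≤ k → resForm (c k) = C (a0 k) * (∑ i, C (ℓ k i) * X i) ^ d)
    (hdir : ∀ k, k₀ ≤ k → ℓ k (j k) + dotProduct (ℓ k) (b k) = 0) (hlam : ∀ k, k₀ ≤ k → lam k ≠ 0)
    (hprop : ∀ k, k₀ ≤ k → ∀ i, i ≠ j k → ℓ (k + 1) i = lam k * ℓ k i)
    (hcarry : ∀ k, k₀ ≤ k → ∃ i, i ≠ j k ∧ ℓ k i ≠ 0) {k : ℕ} {a a' f : Fin 4} (haa : a ≠ a')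
    (haf : a ≠ f) (ha'f : a' ≠ f) (hℓf : ℓ k f ≠ 0) (hrf : (c k).r f = 0)
    {ta ta' : ℕ} (hta : k₀ ≤ ta) (htak : ta < k) (hja : j ta = a)
    (hkepta : ∀ m, ta < m → m < k → j m ≠ a ∧ b m a = 0) (hta' : k₀ ≤ ta') (hta'k : ta' < k)
    (hja' : j ta' = a') (hkepta' : ∀ m, ta' < m → m < k → j m ≠ a' ∧ b m a' = 0) :
    ∀ e ∈ (deletePthPowers p (tsch f (∑ i, C ((fun i => if i = f then (0 : K) else -(ℓ k i / ℓ k f)) i) * X i)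
        (c k).F)).support, e f < d → (c k).r a + 1 ≤ e a ∧ (c k).r a' + 1 ≤ e a' := by
  classical
  obtain ⟨U, S, T, hU, hledger⟩ := stretch_pair_ledger_linear p hc hw hr0 hfloor hd hshade hform hdir hlam hprop
    hcarry haa haf.symm ha'f.symm hℓf hta htak hja hkepta hta' hta'k hja' hkepta'
  have hr := IsolatedBand.isolated_chain_forall_le hc hr0 k
  obtain ⟨-, h0, -⟩ := straighten_datum_admissible (K := K) (f := f) (ℓ k)
  exact lowLedger_deletePthPowers p (lowLedger_tsch_of_pair_ledger_linear haf ha'f h0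
    (tsch_linearForm_straighten hℓf) hrf (monomial_mul_divMonomial hr).symm hU hledger)

end Chain

end ResCone

end Summit.ResolutionOfSingularities.ResolutionOfSingularities.Theorems.PIDim4

end
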